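import Summits.BirchSwinnertonDyer.BirchSwinnertonDyer.Theorems.PrintX11aLowerHalfNonSurjEndpoint
import Summits.BirchSwinnertonDyer.BirchSwinnertonDyer.Theorems.PrintX11aEulerHalfGlue
import Summits.BirchSwinnertonDyer.BirchSwinnertonDyer.Theses.PrintX11a
import Literature.NumberTheory.EllipticCurves.SteinWuthrich2013.NonsplitLeadingTermRankZeroOfGreenbergProofs
import Literature.NumberTheory.EllipticCurves.SteinWuthrich2013.SplitMultLeadingTermOfEulerCharProofs
import Literature.NumberTheory.EllipticCurves.AnalyticRankModularityProofs
import Literature.NumberTheory.EllipticCurves.ModularParametrizationTrustBaseProofs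
import Literature.NumberTheory.EllipticCurves.ModularParametrizationDegreeHoldsProofs
import HarnessLib

/-!
# Crux `X11aLowerHalf` (item stmt-BirchSwinnertonDyer-19064): its `p ≥ 5` restriction and its whole body from Mazur's
# statement WITHOUT Stein–Wuthrich Thm. 6.1 — the two SW 6.1 binders replaced by Greenberg's rank-`0` formula
# (width seat bsd-line-er5-p2 = -w3, gen 14; `--supports stmt-BirchSwinnertonDyer-19064` helper; no registry verb; the lead decides)

HONEST FRAMING.  Composition theorems only; no definition, no named fact minted, no `sorry`.  Every theorem is
CONDITIONAL on its displayed binders and closes nothing by itself; the research statement of the line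
(`hMC5` = Mazur's cyclotomic main conjecture at the deep X11a pairs with `p ≥ 5`, the registered stub
`stub_mazurMCAtDeepFive` of line «birth» r17, OPEN in print without a (ram) prime) stays OPEN and DISPLAYED.  No
summit statement is proved; BSD is proved for no curve and no class.

WHY.  On line «birth» r17 ∕ candidate r18 the `p ≥ 5` slice of crux L is p657610's
`Birth.lowerX11aFive_of_mazurMCAtDeepFive_of_fiveFacts`: Mazur's statement at the deep pairs + FIVE named facts —
modularity, Stein–Wuthrich 2013 Thm. 6.1 split ∕ non-split (stated for EVERY Mordell–Weil rank; at `r ≥ 1` they rest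
on Jones 1989 Thm. 3.1, registry flag `SW13-Thm61-secondary-Jon89-unread@r≥1`), GZK, Greenberg–Stevens.  X11a is a
rank-`0` class, and the INPUT seats `bsd-input-sw13-{split,nonsplit}-mult` landed the RANK-`0` SLICES of both SW 6.1
facts from Greenberg's "analogue of theorem 4.1" ALONE (LNM 1716 §4, after Prop. 4.8):
`SteinWuthrich2013.thm61_nonsplitMultiplicative_clauses_rankZero_of_greenberg` (p664420, from
`Greenberg1999.thm41Analogue_charValue_rankZero_numberField`) and `SteinWuthrich2013.clauses_rankZero_of_greenberg`
(p662964, from `Greenberg1999.thm41Analogue_charValue_rankZero_split_baseChange_anyPrime`).  This file re-issues the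
rank-`0` glue of `X11a/RankZeroHeightFree.lean` (cell b2b-bsdres gen 18, which discharged the height-EXISTENCE binders
the same way) with the SW 6.1 binder replaced by the Greenberg binder (§1 `bsdp_of_multCharIdeal_{nonsplit,split}_
rankZero_of_greenberg`: verbatim, the `hJ` line calling the slice), then the X2 glue (§2), p646859's per-pair X11a door
(§3), and crux L (§4): the `p ≥ 5` restriction from the registered text `stub_mazurMCAtDeepFive` (`hMC5`) — same
conclusion as p657610's, so it feeds the lead's r18 glue p663752 as `h5` unchanged —, crux L BY NAME from Mazur's
statement at EVERY deep X11a pair, and crux L BY NAME in the lead's r18 shape (item 23178's text at `p = 3` + `hMC5`).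

NUMBERS.  Facts on L's `p ≥ 5` slice: before {modularity, SW 6.1 ×2, GZK, GS}; after {modularity, Greenberg §4
analogue non-split ∕ split, GZK, GS} — still 5, but both SW 6.1 binders (and the Jones flag) leave L's cone; the two
Greenberg facts are EXISTING typed facts (flags `Gr99-Thm41-analogue-display`, `Gr99-split-basechange-specialisation`;
the split fact is the parity-free sibling of record, consumed here at odd `p`).  In the r18 shape the nine shrink to
modularity + GS + Greenberg ×2 (no SW 6.1, no Kato 12.4 ∕ §17.13, no Mazur 4.1).  An OPTION for the lead ∕ planner, not
a reshape (r18 keeps `stub_nineFactsOddGS` verbatim for W-81′ sharing with U3 ∕ U5).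

References: [GreenbergLNM1716] §4 Thm. 4.1 and the passage following Prop. 4.8 (pp. 112–113), §3 p. 94;
[SteinWuthrich2013] Thm. 6.1, §4.2; [GreenbergStevens1993]; [MazurTateTeitelbaum1986Invent] §I.14–15;
[Skinner2016PacificMC] Thm. A (shape only); [Miller2011LMS] Def. 1.1; tree `X11a/RankZeroHeightFree.lean`, p657610,
p646859, p663752, `Cruxes/X11aLowerHalf/Lines/birth.lean` (r17).
-/

set_option autoImplicit false
set_option linter.dupNamespace false -- the directory name repeats the summit name (sibling precedent)
noncomputable section

open scoped Classical MatrixGroups ModularForm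

open CongruenceSubgroup WeierstrassCurve Literature.NumberTheory.EllipticCurves
  Literature.NumberTheory.EllipticCurves.ModularForms
  Literature.NumberTheory.EllipticCurves.Rank1Residual
  Literature.NumberTheory.EllipticCurves.Rank1Residual.Typed
  Literature.NumberTheory.EllipticCurves.GreenbergVatsal2000
  Literature.NumberTheory.EllipticCurves.Wuthrich2014
  Literature.NumberTheory.EllipticCurves.SteinWuthrich2013
  Summit.BirchSwinnertonDyer.Rank1Residual
  Summit.BirchSwinnertonDyer.Rank1Residual.RankZeroHeightFree

namespace Summit.BirchSwinnertonDyer.BirchSwinnertonDyer.Theorems.GreenbergRankZero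

/-! ### §1 The rank-`0` glue at a multiplicative prime with Greenberg's formula in place of Stein–Wuthrich Thm. 6.1 -/

/-- **Rank `0`, NON-split multiplicative `p ≠ 2`: `BSD(E,p)` from the main-conjecture EQUALITY `hMC` (`X` torsion,
`char_Λ X = (g)`, `ι(g · w) = ϖ · L`, `w ∈ Λˣ`) — with Greenberg's rank-`0` formula `hG` (LNM 1716 §4, "the analogue of
theorem 4.1", non-split `v ∣ p`, `p` odd) in place of Stein–Wuthrich Thm. 6.1.**  Verbatim
`RankZeroHeightFree.bsdp_of_multCharIdeal_nonsplit_rankZero_heightFree` except that clause 3 in rank `0`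
(`g(0) · #E(ℚ)_tors² = u · 2 · #Ш(p) · ∏ c_v`, `Reg_p = 1` for the zero datum) is the INPUT seat's slice
`SteinWuthrich2013.thm61_nonsplitMultiplicative_clauses_rankZero_of_greenberg hG` (no Tate parameter, no
cyclotomic-variable normalisation of `γ`).  Chain: `g(0)·w(0) = ϖ · L(0) = 2ϖ[0]⁺_f`; valuations.
-- adapted from Summits/BirchSwinnertonDyer/Rank1Residual/X11a/RankZeroHeightFree.lean
[cite: GreenbergLNM1716, §4, the passage following Prop. 4.8 (pp. 112–113, "the analogue of theorem 4.1")]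
[cite: MazurTateTeitelbaum1986Invent, §I.14] [cite: Miller2011LMS, Def. 1.1 and §1] -/
theorem bsdp_of_multCharIdeal_nonsplit_rankZero_of_greenberg
    (hG : Greenberg1999.thm41Analogue_charValue_rankZero_numberField)
    (hGZK : rank_eq_analyticRank_of_analyticRank_le_one)
    (hmod : hasEntireLFunction_rat)
    (W : WeierstrassCurve ℚ) [W.IsElliptic] [W.IsGloballyMinimal] (p : ℕ) [Fact p.Prime]
    {κ : ZpExtension ℚ p} {γ : Field.absoluteGaloisGroup ℚ} {N : ℕ} [NeZero N]
    {f : CuspForm (Gamma0 N) 2} (hp : p ≠ 2) (hr : W.analyticRank = 0)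
    (hmult : W.HasMultiplicativeReductionAtPrime p)
    (hns : ¬ W.HasSplitMultiplicativeReductionAtPrime p)
    (hκ : κ.IsCyclotomic) (hγ : κ.IsTopGenerator γ)
    (hf : IsNewformOf W f) (D : W.SelmerDualData κ γ) (ϖ : ℚ) (hϖ0 : ϖ ≠ 0)
    (hϖ : (ϖ : ℝ) * W.realPeriodRat = plusPeriod f)
    (L : PowerSeries ℚ_[p]) (hL : IsMultPAdicLFunctionOf f p (-1) L)
    (hMC : D.IsTorsion ∧ ∃ (g : IwasawaAlgebra p) (w : (IwasawaAlgebra p)ˣ),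
      D.charIdeal = Ideal.span {g} ∧
      iwasawaToPowerSeries p (g * (w : IwasawaAlgebra p)) = PowerSeries.C ((ϖ : ℚ) : ℚ_[p]) * L) :
    BSDp W p := by
  have hpP : p.Prime := Fact.out
  haveI : Module.Finite (IwasawaAlgebra p) D.X := D.module_finite_holds hγ
  obtain ⟨hX, g, w, hchar, hw⟩ := hMC
  have hL1 : W.entireLFunction 1 ≠ 0 := (W.analyticRank_eq_zero_iff_holds (hmod W)).1 hr
  obtain ⟨hrank, hfin⟩ := hGZK W (by omega)
  have hr0 : W.mordellWeilRank = 0 := by rw [hrank, hr]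
  haveI : Finite W.toAffine.Point := W.mordellWeilRank_eq_zero_iff_finite.mp hr0
  haveI : Finite W.sha := hfin
  haveI : Finite (AddCommGroup.primaryComponent W.sha p) := inferInstance
  set s : ℚ := ratPlusSymbol f 0 with hs_def
  set t : ℚ := ϖ * s with ht_def
  have hΩpos : 0 < W.realPeriodRat := W.realPeriodRat_pos_holds
  have hLval : W.entireLFunction 1 = (((s : ℝ) * plusPeriod f : ℝ) : ℂ) := hf.entireLFunction_one_eq
  have hq : W.entireLFunction 1 / (W.realPeriodRat : ℂ) = ((t : ℚ) : ℂ) := by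
    rw [hLval, ← hϖ, div_eq_iff (Complex.ofReal_ne_zero.mpr hΩpos.ne'), ht_def]
    push_cast
    ring
  have hs0 : s ≠ 0 := by
    intro h0
    apply hL1
    rw [hLval, h0]
    simp
  have ht0 : t ≠ 0 := mul_ne_zero hϖ0 hs0
  set Dh : PAdicHeightData W p := PAdicHeightData.zero W p with hDh_def
  have hReg : padicRegulator Dh = 1 := padicRegulator_eq_one_of_finite W p Dh
  have hSch : SchneiderConjecture Dh := by
    rw [SchneiderConjecture, hReg]
    exact one_ne_zero
  -- Greenberg's rank-`0` formula in the shape of Stein–Wuthrich Thm. 6.1, clause 3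
  obtain ⟨-, -, h3⟩ :=
    SteinWuthrich2013.thm61_nonsplitMultiplicative_clauses_rankZero_of_greenberg hG hp hmult hns hκ hγ D hX
      hchar Dh hr0
  obtain ⟨u, hu⟩ := h3 hSch inferInstance
  simp only [hr0, pow_zero, mul_one, hReg, PowerSeries.coeff_zero_eq_constantCoeff] at hu
  have hL0 : PowerSeries.constantCoeff L = 2 * (s : ℚ_[p]) := hL.constantCoeff_of_neg_one
  have hgw : PowerSeries.constantCoeff (g * (w : IwasawaAlgebra p)) =
      PowerSeries.constantCoeff g * PowerSeries.constantCoeff (w : IwasawaAlgebra p) := map_mul _ _ _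
  have h0 := congrArg PowerSeries.constantCoeff hw
  rw [constantCoeff_iwasawaToPowerSeries, hgw, PadicInt.coe_mul, map_mul,
    PowerSeries.constantCoeff_C, hL0] at h0
  have hwu : IsUnit (PowerSeries.constantCoeff (w : IwasawaAlgebra p)) :=
    PowerSeries.isUnit_constantCoeff _ w.isUnit
  set w0 : ℤ_[p]ˣ := hwu.unit with hw0_def
  have hw0 : ((w0 : ℤ_[p]) : ℚ_[p]) = ((PowerSeries.constantCoeff (w : IwasawaAlgebra p) : ℤ_[p]) : ℚ_[p]) := by
    rw [hw0_def, IsUnit.unit_spec]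
  have htcast : ((t : ℚ) : ℚ_[p]) = (ϖ : ℚ_[p]) * (s : ℚ_[p]) := by
    rw [ht_def]; push_cast; ring
  have key : (t : ℚ_[p]) * (W.torsionOrder : ℚ_[p]) ^ 2 =
      (((u : ℤ_[p]) : ℚ_[p]) * ((w0 : ℤ_[p]) : ℚ_[p])) *
        (Nat.card (AddCommGroup.primaryComponent W.sha p) : ℚ_[p]) * (W.tamagawaProduct : ℚ_[p]) := by
    apply mul_left_cancel₀ (two_ne_zero : (2 : ℚ_[p]) ≠ 0)
    rw [htcast, hw0]
    linear_combination ((PowerSeries.constantCoeff (w : IwasawaAlgebra p) : ℤ_[p]) : ℚ_[p]) * hu -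
      (W.torsionOrder : ℚ_[p]) ^ 2 * h0
  have hval := padicValRat_eq_of_torsionSq_mul_eq W p ht0 _
    (by rw [Padic.valuation_mul (coe_units_ne_zero p u) (coe_units_ne_zero p w0),
      valuation_coe_units_eq_zero, valuation_coe_units_eq_zero, add_zero])
    (mul_ne_zero (coe_units_ne_zero p u) (coe_units_ne_zero p w0)) key
  exact bsdp_of_padicValRat_rank_zero W p hr hL1 hGZK ⟨t, hq, hval⟩

/-- **Rank `0`, SPLIT multiplicative `p ≠ 2`: `BSD(E,p)` from the main-conjecture EQUALITY, Greenberg–Stevens and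
`𝓛_p ≠ 0` — with Greenberg's rank-`0` formula `hG` (LNM 1716 §4 with §3 p. 94, split `v ∣ p`, `l_v = 𝓛_p/(2p)`; the
parity-free base-change fact of record, consumed at odd `p`) in place of Stein–Wuthrich Thm. 6.1.**  Verbatim
`RankZeroHeightFree.bsdp_of_multCharIdeal_split_rankZero_heightFree` except that clause 3 in rank `0`
(`g(0) · log_p(γ_cyc) · #E(ℚ)_tors² = u · 𝓛_p · #Ш(p) · ∏ c_v`, `Reg_p = 1`) is the INPUT seat's slice
`SteinWuthrich2013.clauses_rankZero_of_greenberg hG`.  Chain: `[T¹]ι(T·g·w) = g(0)·w(0) = ϖ·[T¹]L`, Greenberg–Stevens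
`[T¹]L · log κ(γ_cyc) = 𝓛_p · [0]⁺_f`, cancel `𝓛_p ≠ 0`, valuations.
-- adapted from Summits/BirchSwinnertonDyer/Rank1Residual/X11a/RankZeroHeightFree.lean
[cite: GreenbergLNM1716, §4, the passage following Prop. 4.8 (pp. 112–113) and §3 p. 94]
[cite: GreenbergStevens1993, Thm. (trivial zero)] [cite: Miller2011LMS, Def. 1.1 and §1] -/
theorem bsdp_of_multCharIdeal_split_rankZero_of_greenberg
    (hG : Greenberg1999.thm41Analogue_charValue_rankZero_split_baseChange_anyPrime)
    (hGZK : rank_eq_analyticRank_of_analyticRank_le_one)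
    (hmod : hasEntireLFunction_rat)
    (W : WeierstrassCurve ℚ) [W.IsElliptic] [W.IsGloballyMinimal] (p : ℕ) [Fact p.Prime]
    (hGS : greenberg_stevens (W := W) (p := p)) (h𝓛 : LInvariant_ne_zero (W := W) (p := p))
    {κ : ZpExtension ℚ p} {γ : Field.absoluteGaloisGroup ℚ} {N : ℕ} [NeZero N]
    {f : CuspForm (Gamma0 N) 2} (hp : p ≠ 2) (hr : W.analyticRank = 0)
    (Dq : TateParameterData W p)
    (hκ : κ.IsCyclotomic) (hγ : κ.IsTopGenerator γ)
    (hf : IsNewformOf W f) (D : W.SelmerDualData κ γ) (ϖ : ℚ) (hϖ0 : ϖ ≠ 0)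
    (hϖ : (ϖ : ℝ) * W.realPeriodRat = plusPeriod f)
    (L : PowerSeries ℚ_[p]) (hL : IsSplitMultPAdicLFunctionOf f p L)
    (hMC : D.IsTorsion ∧ ∃ (g : IwasawaAlgebra p) (w : (IwasawaAlgebra p)ˣ),
      D.charIdeal = Ideal.span {g} ∧
      iwasawaToPowerSeries p ((PowerSeries.X : IwasawaAlgebra p) * g * (w : IwasawaAlgebra p)) =
        PowerSeries.C ((ϖ : ℚ) : ℚ_[p]) * L) :
    BSDp W p := by
  have hpP : p.Prime := Fact.out
  haveI : Module.Finite (IwasawaAlgebra p) D.X := D.module_finite_holds hγ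
  obtain ⟨hX, g, w, hchar, hw⟩ := hMC
  have hL1 : W.entireLFunction 1 ≠ 0 := (W.analyticRank_eq_zero_iff_holds (hmod W)).1 hr
  obtain ⟨hrank, hfin⟩ := hGZK W (by omega)
  have hr0 : W.mordellWeilRank = 0 := by rw [hrank, hr]
  haveI : Finite W.toAffine.Point := W.mordellWeilRank_eq_zero_iff_finite.mp hr0
  haveI : Finite W.sha := hfin
  haveI : Finite (AddCommGroup.primaryComponent W.sha p) := inferInstance
  set s : ℚ := ratPlusSymbol f 0 with hs_def
  set t : ℚ := ϖ * s with ht_def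
  have hΩpos : 0 < W.realPeriodRat := W.realPeriodRat_pos_holds
  have hLval : W.entireLFunction 1 = (((s : ℝ) * plusPeriod f : ℝ) : ℂ) := hf.entireLFunction_one_eq
  have hq : W.entireLFunction 1 / (W.realPeriodRat : ℂ) = ((t : ℚ) : ℂ) := by
    rw [hLval, ← hϖ, div_eq_iff (Complex.ofReal_ne_zero.mpr hΩpos.ne'), ht_def]
    push_cast
    ring
  have hs0 : s ≠ 0 := by
    intro h0
    apply hL1
    rw [hLval, h0]
    simp
  have ht0 : t ≠ 0 := mul_ne_zero hϖ0 hs0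
  set Dh : PAdicHeightData W p := PAdicHeightData.zero W p with hDh_def
  have hReg : padicRegulator Dh = 1 := padicRegulator_eq_one_of_finite W p Dh
  have hSch : SchneiderConjecture Dh := by
    rw [SchneiderConjecture, hReg]
    exact one_ne_zero
  -- Greenberg's rank-`0` formula (split) in the shape of Stein–Wuthrich Thm. 6.1, clause 3
  obtain ⟨-, -, h3⟩ := SteinWuthrich2013.clauses_rankZero_of_greenberg hG hp Dq hκ hγ D hX hchar Dh hr0
  obtain ⟨u, hu⟩ := h3 hSch inferInstance
  simp only [hr0, zero_add, pow_one, hReg, mul_one, PowerSeries.coeff_zero_eq_constantCoeff] at hu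
  obtain ⟨-, hGS1⟩ := hGS Dq hf hL
  have hgw : PowerSeries.constantCoeff (g * (w : IwasawaAlgebra p)) =
      PowerSeries.constantCoeff g * PowerSeries.constantCoeff (w : IwasawaAlgebra p) := map_mul _ _ _
  have h1 : ((PowerSeries.constantCoeff g : ℤ_[p]) : ℚ_[p]) *
      ((PowerSeries.constantCoeff (w : IwasawaAlgebra p) : ℤ_[p]) : ℚ_[p]) =
        ((ϖ : ℚ) : ℚ_[p]) * PowerSeries.coeff 1 L := by
    have h := congrArg (PowerSeries.coeff 1) hw
    rw [show (PowerSeries.X : IwasawaAlgebra p) * g * (w : IwasawaAlgebra p) =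
        PowerSeries.X * (g * (w : IwasawaAlgebra p)) from mul_assoc _ _ _] at h
    rw [iwasawaToPowerSeries, PowerSeries.coeff_map, PowerSeries.coeff_succ_X_mul,
      PowerSeries.coeff_zero_eq_constantCoeff, hgw, PowerSeries.coeff_C_mul, map_mul] at h
    exact h
  have hwu : IsUnit (PowerSeries.constantCoeff (w : IwasawaAlgebra p)) :=
    PowerSeries.isUnit_constantCoeff _ w.isUnit
  set w0 : ℤ_[p]ˣ := hwu.unit with hw0_def
  have hw0 : ((w0 : ℤ_[p]) : ℚ_[p]) = ((PowerSeries.constantCoeff (w : IwasawaAlgebra p) : ℤ_[p]) : ℚ_[p]) := by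
    rw [hw0_def, IsUnit.unit_spec]
  have htcast : ((t : ℚ) : ℚ_[p]) = (ϖ : ℚ_[p]) * (s : ℚ_[p]) := by
    rw [ht_def]; push_cast; ring
  have h𝓛0 : LInvariant Dq ≠ 0 := h𝓛 Dq
  have key : (t : ℚ_[p]) * (W.torsionOrder : ℚ_[p]) ^ 2 =
      (((u : ℤ_[p]) : ℚ_[p]) * ((w0 : ℤ_[p]) : ℚ_[p])) *
        (Nat.card (AddCommGroup.primaryComponent W.sha p) : ℚ_[p]) * (W.tamagawaProduct : ℚ_[p]) := by
    apply mul_left_cancel₀ h𝓛0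
    rw [htcast, hw0]
    linear_combination (-(((ϖ : ℚ) : ℚ_[p]) * (W.torsionOrder : ℚ_[p]) ^ 2)) * hGS1 -
      (padicLog p (cyclotomicGenerator p) * (W.torsionOrder : ℚ_[p]) ^ 2) * h1 +
      ((PowerSeries.constantCoeff (w : IwasawaAlgebra p) : ℤ_[p]) : ℚ_[p]) * hu
  have hval := padicValRat_eq_of_torsionSq_mul_eq W p ht0 _
    (by rw [Padic.valuation_mul (coe_units_ne_zero p u) (coe_units_ne_zero p w0),
      valuation_coe_units_eq_zero, valuation_coe_units_eq_zero, add_zero])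
    (mul_ne_zero (coe_units_ne_zero p u) (coe_units_ne_zero p w0)) key
  exact bsdp_of_padicValRat_rank_zero W p hr hL1 hGZK ⟨t, hq, hval⟩

/-! ### §2 Mazur's main conjecture at a rank-`0` pair ⟹ `BSD(E,p)`, without Stein–Wuthrich Thm. 6.1 -/

/-- **Rank `0` at an odd multiplicative prime: Mazur's main conjecture at `(E,p)` gives `BSD(E,p)` — from
Greenberg's rank-`0` formula ×2 (`hGs` split ∕ `hGn` non-split), Greenberg–Stevens (`hGS`), GZK (`hGZK`) and
modularity (`hmod`, `hpar`) ONLY.**  Verbatim `X2.bsdp_of_mazurMainConjectureAt_of_analyticRank_eq_zero_heightFree`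
(data from tree theorems, `𝓛_p ≠ 0` = `LInvariant_ne_zero_holds`) over §1.  No image hypothesis; no SW 6.1; no height
fact.  PER PAIR; CONDITIONAL on `hMC`.
-- adapted from Summits/BirchSwinnertonDyer/Rank1Residual/X11a/RankZeroHeightFree.lean
[cite: GreenbergLNM1716, §4 (pp. 112–113) and §3 p. 94] [cite: Miller2011LMS, Def. 1.1 and §1] -/
theorem bsdp_of_mazurMainConjectureAt_of_analyticRank_eq_zero_of_greenberg
    (hGs : Greenberg1999.thm41Analogue_charValue_rankZero_split_baseChange_anyPrime)
    (hGn : Greenberg1999.thm41Analogue_charValue_rankZero_numberField)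
    (hGZK : rank_eq_analyticRank_of_analyticRank_le_one) (hmod : hasEntireLFunction_rat)
    (hpar : nonempty_modularParametrizationData)
    (W : WeierstrassCurve ℚ) [W.IsElliptic] [W.IsGloballyMinimal] (p : ℕ) [Fact p.Prime]
    (hGS : greenberg_stevens (W := W) (p := p))
    (hp : p ≠ 2) (hmult : W.HasMultiplicativeReductionAtPrime p) (hr : W.analyticRank = 0)
    (hMC : X2.MazurMainConjectureAt W p) : BSDp W p := by
  obtain ⟨κ, hκ, γ, hγ, hγ'⟩ := exists_isCyclotomic_isTopGenerator_isCyclotomicVariable_holds p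
  obtain ⟨D⟩ := W.nonempty_selmerDualData_holds κ γ hγ
  haveI : NeZero (W.conductorNorm ℤ) := ⟨(W.conductorNorm_pos_holds).ne'⟩
  obtain ⟨Dm⟩ := hpar W
  obtain ⟨ϖ, hϖpos, hϖ, -⟩ := Dm.exists_rat_mul_realPeriodRat_eq_plusPeriod
  obtain ⟨hX, g, hchar, hsp, hnsp⟩ := hMC κ γ hκ hγ hγ' Dm.f Dm.isNewformOf D ϖ hϖ
  by_cases hsplit : W.HasSplitMultiplicativeReductionAtPrime p
  · obtain ⟨L, hL⟩ := exists_isSplitMultPAdicLFunctionOf hsplit Dm.isNewformOf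
    obtain ⟨Dq⟩ := (nonempty_tateParameterData_iff_holds (W := W) (p := p)).mpr hsplit
    obtain ⟨w, hw⟩ := hsp hsplit L hL
    exact bsdp_of_multCharIdeal_split_rankZero_of_greenberg hGs hGZK hmod W p hGS
      LInvariant_ne_zero_holds hp hr Dq hκ hγ Dm.isNewformOf D ϖ hϖpos.ne' hϖ L hL
      ⟨hX, g, w, hchar, hw⟩
  · obtain ⟨L, hL⟩ := exists_isMultPAdicLFunctionOf_neg_one_of_nonsplit Dm.isNewformOf hmult hsplit
    obtain ⟨w, hw⟩ := hnsp hsplit L hL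
    exact bsdp_of_multCharIdeal_nonsplit_rankZero_of_greenberg hGn hGZK hmod W p hp hr hmult hsplit
      hκ hγ Dm.isNewformOf D ϖ hϖpos.ne' hϖ L hL ⟨hX, g, w, hchar, hw⟩

/-! ### §3 The door on class X11a: Mazur's statement at the pair ⟹ the lower half, without Stein–Wuthrich Thm. 6.1 -/

/-- **The lower half at an X11a pair, ANY prime of the class, from Mazur's statement at the pair** (`hMC :
X2.MazurMainConjectureAt W p`, displayed) and FIVE named facts: modularity (`hNf`), Greenberg's rank-`0` formula at a
split ∕ non-split multiplicative prime (`hGs`, `hGn`), GZK (`hGZK`), Greenberg–Stevens at the pair (`hGS`) — the twin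
of p646859's `ClassX11a.missingLowerBoundAt_of_mazurMainConjectureAt_of_facts` with the two Stein–Wuthrich Thm. 6.1
binders replaced (§2 + the class bridge `ClassX11a.missingLowerBoundAt_of_bsdp`).  PER PAIR; CONDITIONAL on `hMC`;
closes nothing class-wide.
[cite: GreenbergLNM1716, §4 (pp. 112–113)] [cite: MazurTateTeitelbaum1986Invent, §I.14 (shape only)]
[cite: Miller2011LMS, Def. 1.1] -/
theorem _root_.Summit.BirchSwinnertonDyer.Rank1Residual.ClassX11a.missingLowerBoundAt_of_mazurMainConjectureAt_of_greenberg
    {W : WeierstrassCurve ℚ} [W.IsElliptic] [W.IsGloballyMinimal] {p : ℕ} [Fact p.Prime]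
    (hNf : exists_isNewformOf)
    (hGs : Greenberg1999.thm41Analogue_charValue_rankZero_split_baseChange_anyPrime)
    (hGn : Greenberg1999.thm41Analogue_charValue_rankZero_numberField)
    (hGZK : rank_eq_analyticRank_of_analyticRank_le_one) (hGS : greenberg_stevens (W := W) (p := p))
    (hX : ClassX11a W p) (hMC : X2.MazurMainConjectureAt W p) : MissingLowerBoundAt W p := by
  have hmod : hasEntireLFunction_rat := hasEntireLFunction_rat_of_exists_isNewformOf hNf
  have hpar : nonempty_modularParametrizationData :=
    nonempty_modularParametrizationData_of_exists_isNewformOf hNf IsNewformOf.exists_maninConstant_ne_zero_holds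
  exact hX.missingLowerBoundAt_of_bsdp hGZK
    (bsdp_of_mazurMainConjectureAt_of_analyticRank_eq_zero_of_greenberg hGs hGn hGZK hmod hpar W p hGS
      hX.ne_two hX.mult hX.1 hMC)

/-! ### §4 Crux L: the `p ≥ 5` restriction, and the whole crux by name, from Mazur's statement at the deep pairs -/

/-- **The `p ≥ 5` restriction of crux `X11aLowerHalf` from Mazur's statement at the deep X11a pairs with `p ≥ 5`
and FIVE named facts WITHOUT Stein–Wuthrich Thm. 6.1**: modularity `hNf`, Greenberg's rank-`0` formula split ∕
non-split `hGs` ∕ `hGn`, GZK `hGZK`, Greenberg–Stevens at odd `p` `hGS`, and `hMC5` = the registered r17 ∕ r18 text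
`stub_mazurMCAtDeepFive` VERBATIM (Mazur's cyclotomic main conjecture at `(E, p)` for every deep X11a pair with
`p ≥ 5`, both images; OPEN class-wide — printed only under (ram), Skinner 2016 Thm. A).  Unit pairs free; deep pairs
through §3.  Twin of p657610's `Birth.lowerX11aFive_of_mazurMCAtDeepFive_of_fiveFacts` with `hJs` ∕ `hJn` replaced;
same conclusion, so it feeds the lead's r18 glue (p663752) as its binder `h5` unchanged.  CONDITIONAL; closes nothing.
[cite: Skinner2016PacificMC, Thm. A (shape only; printed under (ram))] [cite: GreenbergLNM1716, §4 (pp. 112–113)]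
[cite: Miller2011LMS, Def. 1.1 (arXiv:1010.2431 p. 3)] -/
theorem lowerX11aFive_of_mazurMCAtDeepFive_of_greenberg_of_threeFacts
    (hNf : exists_isNewformOf)
    (hGs : Greenberg1999.thm41Analogue_charValue_rankZero_split_baseChange_anyPrime)
    (hGn : Greenberg1999.thm41Analogue_charValue_rankZero_numberField)
    (hGZK : rank_eq_analyticRank_of_analyticRank_le_one)
    (hGS : ∀ (W : WeierstrassCurve ℚ) [W.IsElliptic] [W.IsGloballyMinimal] (p : ℕ) [Fact p.Prime],
      p ≠ 2 → greenberg_stevens (W := W) (p := p))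
    (hMC5 : ∀ (W : WeierstrassCurve ℚ) [W.IsElliptic] [W.IsGloballyMinimal] (p : ℕ) [Fact p.Prime],
      ClassX11a W p → 5 ≤ p → ¬ X11a.ShaAnUnit W p → X2.MazurMainConjectureAt W p) :
    ∀ (W : WeierstrassCurve ℚ) [W.IsElliptic] [W.IsGloballyMinimal] (p : ℕ) [Fact p.Prime],
      ClassX11a W p → 5 ≤ p → MissingLowerBoundAt W p := by
  intro W _ _ p _ hX hp5
  by_cases hu : X11a.ShaAnUnit W p
  · exact x11a_missingLowerBoundAt_of_shaAnUnit hu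
  · exact hX.missingLowerBoundAt_of_mazurMainConjectureAt_of_greenberg hNf hGs hGn hGZK (hGS W p hX.ne_two)
      (hMC5 W p hX hp5 hu)

/-- **Crux `X11aLowerHalf` BY NAME (`Theses.PrintX11a.X11aLowerHalf`, item 19064) from Mazur's statement at EVERY
deep X11a pair** (`hMC` : at every X11a pair `(E, p)` — any odd `p`, both images — with `#Ш(E)_an` not a `p`-adic
unit, `X2.MazurMainConjectureAt W p`; = the registered text `stub_mazurMCAtDeepFive` at `p ≥ 5` and, at `p = 3`, a
statement STRONGER than `stub_mazurMCAtTresRamifieThree` (no finite-flat exclusion) — ONE binder, OPEN) **and FIVE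
named facts WITHOUT Stein–Wuthrich Thm. 6.1, Kato, EPW or Mazur 4.1**: modularity, Greenberg's rank-`0` formula ×2,
GZK, Greenberg–Stevens.  Unit pairs free; deep pairs through §3.  CONDITIONAL; closes nothing; BSD is not proved.
[cite: Skinner2016PacificMC, Thm. A (shape only; printed under (ram))] [cite: GreenbergLNM1716, §4 (pp. 112–113)]
[cite: Miller2011LMS, Def. 1.1 (arXiv:1010.2431 p. 3)] -/
theorem x11aLowerHalf_of_forall_mazurMCAtDeep_of_greenberg_of_threeFacts
    (hNf : exists_isNewformOf)
    (hGs : Greenberg1999.thm41Analogue_charValue_rankZero_split_baseChange_anyPrime)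
    (hGn : Greenberg1999.thm41Analogue_charValue_rankZero_numberField)
    (hGZK : rank_eq_analyticRank_of_analyticRank_le_one)
    (hGS : ∀ (W : WeierstrassCurve ℚ) [W.IsElliptic] [W.IsGloballyMinimal] (p : ℕ) [Fact p.Prime],
      p ≠ 2 → greenberg_stevens (W := W) (p := p))
    (hMC : ∀ (W : WeierstrassCurve ℚ) [W.IsElliptic] [W.IsGloballyMinimal] (p : ℕ) [Fact p.Prime],
      ClassX11a W p → ¬ X11a.ShaAnUnit W p → X2.MazurMainConjectureAt W p) :
    Summit.BirchSwinnertonDyer.BirchSwinnertonDyer.Theses.PrintX11a.X11aLowerHalf := by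
  intro W _ _ p _ hX
  by_cases hu : X11a.ShaAnUnit W p
  · exact x11a_missingLowerBoundAt_of_shaAnUnit hu
  · exact hX.missingLowerBoundAt_of_mazurMainConjectureAt_of_greenberg hNf hGs hGn hGZK (hGS W p hX.ne_two)
      (hMC W p hX hu)

/-- **Crux `X11aLowerHalf` BY NAME in the shape of the lead's candidate r18 composition, WITHOUT Stein–Wuthrich
Thm. 6.1**: from the text of item stmt-BirchSwinnertonDyer-23178 `X11aLowerHalfAtThree` VERBATIM (`hA`, the `p = 3`
child of r18), the registered text `stub_mazurMCAtDeepFive` VERBATIM (`hMC5`, OPEN) and the five rank-`0` ∕ analytic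
facts of §4 — an X11a prime is odd, so `p = 3 ∨ 5 ≤ p` (pure logic), the `p ≥ 5` branch being
`lowerX11aFive_of_mazurMCAtDeepFive_of_greenberg_of_threeFacts`.  Compare the lead's
`Birth.x11aLowerHalf_of_lowerAtThree_of_children_r18 (hA) (h9 : nine facts) (hGZK) (hMC5)` (p663752): here the nine
shrink to modularity + Greenberg–Stevens + the two Greenberg formulas.  CONDITIONAL; closes nothing; BSD is not proved.
[cite: Skinner2016PacificMC, Thm. A (shape only; printed under (ram))] [cite: GreenbergLNM1716, §4 (pp. 112–113)]
[cite: Miller2011LMS, Def. 1.1 (arXiv:1010.2431 p. 3)] -/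
theorem x11aLowerHalf_of_lowerAtThree_of_mazurMCAtDeepFive_of_greenberg_of_threeFacts
    (hA : ∀ (V : WeierstrassCurve ℚ) [V.IsElliptic] [V.IsGloballyMinimal],
      ClassX11a V 3 → MissingLowerBoundAt V 3)
    (hNf : exists_isNewformOf)
    (hGs : Greenberg1999.thm41Analogue_charValue_rankZero_split_baseChange_anyPrime)
    (hGn : Greenberg1999.thm41Analogue_charValue_rankZero_numberField)
    (hGZK : rank_eq_analyticRank_of_analyticRank_le_one)
    (hGS : ∀ (W : WeierstrassCurve ℚ) [W.IsElliptic] [W.IsGloballyMinimal] (p : ℕ) [Fact p.Prime],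
      p ≠ 2 → greenberg_stevens (W := W) (p := p))
    (hMC5 : ∀ (W : WeierstrassCurve ℚ) [W.IsElliptic] [W.IsGloballyMinimal] (p : ℕ) [Fact p.Prime],
      ClassX11a W p → 5 ≤ p → ¬ X11a.ShaAnUnit W p → X2.MazurMainConjectureAt W p) :
    Summit.BirchSwinnertonDyer.BirchSwinnertonDyer.Theses.PrintX11a.X11aLowerHalf := by
  intro W _ _ p _ hX
  by_cases hp5 : 5 ≤ p
  · exact lowerX11aFive_of_mazurMCAtDeepFive_of_greenberg_of_threeFacts hNf hGs hGn hGZK hGS hMC5 W p hX hp5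
  · have hp2 : p ≠ 2 := hX.ne_two
    have hpP : p.Prime := Fact.out
    have h2le : 2 ≤ p := hpP.two_le
    have hlt : p < 5 := Nat.lt_of_not_le hp5
    interval_cases p
    · exact absurd rfl hp2
    · exact hA W hX
    · exact absurd hpP (by norm_num)

end Summit.BirchSwinnertonDyer.BirchSwinnertonDyer.Theorems.GreenbergRankZero

end
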